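import Literature.AlgebraicGeometry.HodgeTheory.FermatShiodaCondition
import HarnessLib

/-!
# The étale step of a cyclic cover: Shioda's Hodge condition is invariant under level-raising `α ↦ e·α` (WEIL-2 gen 33, FERMAT-G33 §2 LEMMA L (i); fact-free)

research route, not a corollary; conditional on HC_CM plus one named minimal statement.

Cell `pub-hodge-ring2-ab-*` (ALL ABELIAN VARIETIES), seat WEIL-2 gen 33, account
`run/shared/lean/pub/pub-hodge-ring2/pub-hodge-ring2-ab-weil-2/FERMAT-G33.md` (§2: THEOREM F_q♮ = THEOREM F_q of FERMAT-G32 WITHOUT its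
hypothesis (H) `gcd(m, α) = 1`; ab-ref finding F-ab-182).

Informal setting (not formalised).  A cyclic `μ_m`-cover `C → X` of a curve of genus `q ≥ 1` whose exponents `α_j ∈ ℤ/m` have a common divisor
`e = gcd(m, α_1, …, α_b) > 1` factors through an ÉTALE `μ_e`-cover `X′ → X`; THEOREM F_q♮ shows that Schoen's Hodge structure `U` is then
supported on the `e` components of the special Abel–Jacobi fibre, each a cone over the quotient `X^{b-2}_{m/e}/G_{α/e}` of the Fermat variety of
the LOWER degree `m/e`, with character `α/e`.  The bookkeeping identity that makes the statement of THEOREM F_q (d)–(e) survive verbatim is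
LEMMA L: `α ∈ 𝔅^{b-2}_m ⟺ α/e ∈ 𝔅^{b-2}_{m/e}` (Hodge characters) and the same for cycle characters (via the level map `z ↦ z^e`).  This file
is the kernel form of the Hodge half, for Shioda's multiset condition `FermatCharacter.IsHodgeMultiset` of the tree
(`Literature/AlgebraicGeometry/HodgeTheory/FermatShiodaCondition.lean`): for every level `k ≥ 1`, every `e ≥ 1` and every multiset `s` of
residues mod `k`, the multiset `e·s` of residues mod `e·k` (multiply representatives by `e`) is a Hodge multiset iff `s` is
(`isHodgeMultiset_map_levelMul_iff`).  Ingredients: `⟨t·(e a)⟩_{ek} = e·⟨t̄ a⟩_k` for `t̄ = t mod k` (`val_mul_levelMul`) and the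
surjectivity of `(ℤ/ek)ˣ → (ℤ/k)ˣ` (`ZMod.unitsMap_surjective`, Mathlib).  Worked instances (§3 of the account, TABLE Q column `e`): the two
`(H)`-violating (3,3) NEW habitat characters `[2,2,8,8,8,8]`, `[4,4,4,4,10,10]` mod `12` of `Ring2AbelianAllFermatQuotientCharactersEllipticSixfolds`
(ℚ(√−3), `ℤ/12 ⋊ ⟨7⟩`, elliptic base, `e = 2`; flagged by ab-ref F-ab-182) ARE the level-raised forms of the tree's Hodge multisets
`{1,1,4,4,4,4}`, `{5,5,2,2,2,2}` mod `6` (`FermatCharacter.isHodgeMultiset_six₁/₅`), where Shioda's condition `(P_6)` holds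
(`shiodaCondition_six`): THEOREM F_1♮ (e) applies to them with the Fermat FOURFOLD of degree `6`.  The remaining `e > 1` characters of the final
TABLE Q are certified in the companion file `Ring2AbelianAllFermatQuotientCharactersEtaleReduced`.
0 sorry, no `def`, no named fact; `HC_CM` does not occur.
-/

open Multiset
open Literature.AlgebraicGeometry.HodgeTheory.FermatCharacter

namespace Summit.HodgeConjecture.Ring2AbelianAll.FermatQuotientEtaleStep

variable {k e : ℕ}

/-- The representative of the level-raised residue `e·a ∈ ℤ/(ek)` is `e` times the representative of `a ∈ ℤ/k`.
[locator FERMAT-G33 §2 LEMMA L]  research route, not a corollary; conditional on HC_CM plus one named minimal statement. -/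
theorem val_levelMul (he : 0 < e) (a : ZMod k) (hk : 0 < k) :
    (((e * a.val : ℕ) : ZMod (e * k))).val = e * a.val := by
  haveI : NeZero k := ⟨hk.ne'⟩
  rw [ZMod.val_natCast]
  exact Nat.mod_eq_of_lt (Nat.mul_lt_mul_of_pos_left (ZMod.val_lt a) he)

/-- `⟨t · (e a)⟩_{ek} = e · ⟨t̄ · a⟩_k` with `t̄ = t mod k`: multiplying by a residue mod `ek` and taking representatives commutes with
level-raising up to the factor `e`.  [locator FERMAT-G33 §2 LEMMA L]
research route, not a corollary; conditional on HC_CM plus one named minimal statement. -/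
theorem val_mul_levelMul (he : 0 < e) (hk : 0 < k) (t : ZMod (e * k)) (a : ZMod k) :
    (t * ((e * a.val : ℕ) : ZMod (e * k))).val = e * ((ZMod.cast t : ZMod k) * a).val := by
  haveI : NeZero k := ⟨hk.ne'⟩
  haveI : NeZero (e * k) := ⟨Nat.mul_ne_zero_iff.mpr ⟨he.ne', hk.ne'⟩⟩
  rw [ZMod.val_mul, val_levelMul he a hk, ZMod.val_mul, ZMod.cast_eq_val, ZMod.val_natCast,
    Nat.mod_mul_mod, ← Nat.mul_mod_mul_left, Nat.mul_left_comm]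

/-- The norm sum `Σ⟨t·b⟩` over the level-raised multiset `e·s ⊂ ℤ/(ek)` equals `e · Σ⟨t̄·a⟩` over `s ⊂ ℤ/k` (`t̄ = t mod k`).
[locator FERMAT-G33 §2 LEMMA L]  research route, not a corollary; conditional on HC_CM plus one named minimal statement. -/
theorem mNormSum_map_levelMul (he : 0 < e) (hk : 0 < k) (t : ZMod (e * k)) (s : Multiset (ZMod k)) :
    mNormSum ((s.map fun a ↦ ((e * a.val : ℕ) : ZMod (e * k))).map fun b ↦ t * b) =
      e * mNormSum (s.map fun a ↦ (ZMod.cast t : ZMod k) * a) := by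
  simp only [mNormSum, Multiset.map_map, Function.comp_def, val_mul_levelMul he hk]
  rw [Multiset.sum_map_mul_left]

/-- Level-raising preserves non-vanishing: `e·a = 0` in `ℤ/(ek)` iff `a = 0` in `ℤ/k`.
[locator FERMAT-G33 §2 LEMMA L]  research route, not a corollary; conditional on HC_CM plus one named minimal statement. -/
theorem levelMul_eq_zero_iff (he : 0 < e) (hk : 0 < k) (a : ZMod k) :
    ((e * a.val : ℕ) : ZMod (e * k)) = 0 ↔ a = 0 := by
  haveI : NeZero k := ⟨hk.ne'⟩
  rw [ZMod.natCast_eq_zero_iff, Nat.mul_dvd_mul_iff_left he, ← ZMod.val_eq_zero]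
  constructor
  · intro h
    exact Nat.eq_zero_of_dvd_of_lt h (ZMod.val_lt a)
  · intro h
    rw [h]; exact dvd_zero k

/-- Level-raising preserves the congruence `Σ a = 0`: the sum of `e·s` vanishes in `ℤ/(ek)` iff the sum of `s` vanishes in `ℤ/k`.
[locator FERMAT-G33 §2 LEMMA L]  research route, not a corollary; conditional on HC_CM plus one named minimal statement. -/
theorem sum_map_levelMul_eq_zero_iff (he : 0 < e) (hk : 0 < k) (s : Multiset (ZMod k)) :
    (s.map fun a ↦ ((e * a.val : ℕ) : ZMod (e * k))).sum = 0 ↔ s.sum = 0 := by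
  haveI : NeZero k := ⟨hk.ne'⟩
  have h1 : (s.map fun a ↦ ((e * a.val : ℕ) : ZMod (e * k))) =
      (s.map fun a ↦ e * a.val).map (Nat.cast : ℕ → ZMod (e * k)) := by
    rw [Multiset.map_map]; rfl
  have h2 : s = (s.map fun a ↦ a.val).map (Nat.cast : ℕ → ZMod k) := by
    rw [Multiset.map_map]
    conv_lhs => rw [← Multiset.map_id s]
    congr 1; funext a; simp
  rw [h1, ← Nat.cast_multiset_sum, ZMod.natCast_eq_zero_iff, Multiset.sum_map_mul_left,
    Nat.mul_dvd_mul_iff_left he]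
  conv_rhs => rw [h2, ← Nat.cast_multiset_sum, ZMod.natCast_eq_zero_iff]

/-- **LEMMA L (i), kernel form: Shioda's Hodge condition is invariant under the étale step.**  For `k, e ≥ 1` and a multiset `s` of residues
mod `k`, the level-raised multiset `e·s` (mod `ek`) is a Hodge multiset iff `s` is.  Geometric meaning: `e·s` is the exponent multiset of a
cyclic `μ_{ek}`-cover with an étale `μ_e`-step, `s` that of the primitive `μ_k`-cover above it; the eigenline `V(e·s)` of the Fermat variety of
degree `ek` is the pull-back of `V(s)` along the level map `z ↦ z^e`, so both have the same Hodge type ([Sch88 Cor 1.9 / Rem 1.10] for the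
cover side).  [locator FERMAT-G33 §2 LEMMA L, THEOREM F_q♮ (d)]
research route, not a corollary; conditional on HC_CM plus one named minimal statement. -/
theorem isHodgeMultiset_map_levelMul_iff (he : 0 < e) (hk : 0 < k) (s : Multiset (ZMod k)) :
    IsHodgeMultiset (s.map fun a ↦ ((e * a.val : ℕ) : ZMod (e * k))) ↔ IsHodgeMultiset s := by
  haveI : NeZero k := ⟨hk.ne'⟩
  haveI : NeZero (e * k) := ⟨Nat.mul_ne_zero_iff.mpr ⟨he.ne', hk.ne'⟩⟩
  have hsurj := ZMod.unitsMap_surjective (n := k) (m := e * k) (Dvd.intro_left e rfl)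
  unfold IsHodgeMultiset
  refine and_congr (and_congr ?_ (sum_map_levelMul_eq_zero_iff he hk s)) ?_
  · constructor
    · intro h a ha h0
      exact h _ (Multiset.mem_map_of_mem _ ha) ((levelMul_eq_zero_iff he hk a).mpr h0)
    · intro h b hb
      obtain ⟨a, ha, rfl⟩ := Multiset.mem_map.mp hb
      exact fun h0 ↦ h a ha ((levelMul_eq_zero_iff he hk a).mp h0)
  · rw [Multiset.card_map]
    constructor
    · intro h t'
      obtain ⟨t, rfl⟩ := hsurj t'
      have ht := h t
      rw [mNormSum_map_levelMul he hk (t : ZMod (e * k)) s] at ht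
      rw [ZMod.unitsMap_val]
      have : e * (2 * mNormSum (s.map fun a ↦ (ZMod.cast (t : ZMod (e * k)) : ZMod k) * a)) = e * (k * card s) := by
        rw [← Nat.mul_left_comm 2, ht]; ring
      exact Nat.eq_of_mul_eq_mul_left he this
    · intro h t
      rw [mNormSum_map_levelMul he hk (t : ZMod (e * k)) s]
      have ht := h (ZMod.unitsMap (Dvd.intro_left e rfl) t)
      rw [ZMod.unitsMap_val] at ht
      calc 2 * (e * mNormSum (s.map fun a ↦ (ZMod.cast (t : ZMod (e * k)) : ZMod k) * a))
          = e * (2 * mNormSum (s.map fun a ↦ (ZMod.cast (t : ZMod (e * k)) : ZMod k) * a)) := by ring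
        _ = e * (k * card s) := by rw [ht]
        _ = e * k * card s := by ring

/-! ### Worked instances: the two `(H)`-violating (3,3) characters of TABLE Q (ζ) -/

/-- Level-raising `ℤ/6 → ℤ/12`, `a ↦ 2a`, maps the tree's Hodge multiset `{1,1,4,4,4,4}` (`isHodgeMultiset_six₁`) to the X-data `[2,2,8,8,8,8]` of the
NEW type of TABLE Q (ζ) with `e = 2` (ℚ(√−3), `ℤ/12 ⋊ ⟨7⟩`, `q = 1`, `g = 27`, class `−[2]`).  [locator FERMAT-G33 §3, TABLE Q column e]
research route, not a corollary; conditional on HC_CM plus one named minimal statement. -/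
theorem map_levelMul_two_1_1_4_4_4_4 :
    (({1, 1, 4, 4, 4, 4} : Multiset (ZMod 6)).map fun a ↦ ((2 * a.val : ℕ) : ZMod (2 * 6))) = ({2, 2, 8, 8, 8, 8} : Multiset (ZMod 12)) := by
  decide

/-- Hence `[2,2,8,8,8,8]` mod `12`, in its level-raised form, is a Hodge multiset BECAUSE `{1,1,4,4,4,4}` mod `6` is (LEMMA L (i) applied; the direct
`decide` proof is `FermatQuotientCharactersEllipticSixfolds.isHodgeMultiset_2_2_8_8_8_8`).  THEOREM F_1♮ (e): its Fermat input is `V_6(t̄·(1,1,4,4,4,4)) ⊂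
H⁴(X⁴_6)`, algebraic under `(P_6)` (`shiodaCondition_six`) — or by the semi-decomposition `[1,1,4 | 4,4,4]` (`isSemiDecomposable_six₁`).
[locator FERMAT-G33 §2 THEOREM F_q♮ (e), §3]  research route, not a corollary; conditional on HC_CM plus one named minimal statement. -/
theorem isHodgeMultiset_map_levelMul_two_1_1_4_4_4_4 :
    IsHodgeMultiset (({1, 1, 4, 4, 4, 4} : Multiset (ZMod 6)).map fun a ↦ ((2 * a.val : ℕ) : ZMod (2 * 6))) :=
  (isHodgeMultiset_map_levelMul_iff (by norm_num) (by norm_num) _).mpr isHodgeMultiset_six₁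

/-- Level-raising `ℤ/6 → ℤ/12` maps the tree's `{5,5,2,2,2,2}` (`isHodgeMultiset_six₅`) to the X-data `[4,4,4,4,10,10]` of the second `e = 2` NEW
type of TABLE Q (ζ) (ℚ(√−3), `ℤ/12 ⋊ ⟨7⟩`, `q = 1`, `g = 27`, class `−[2]`).  [locator FERMAT-G33 §3, TABLE Q column e]
research route, not a corollary; conditional on HC_CM plus one named minimal statement. -/
theorem map_levelMul_two_5_5_2_2_2_2 :
    (({5, 5, 2, 2, 2, 2} : Multiset (ZMod 6)).map fun a ↦ ((2 * a.val : ℕ) : ZMod (2 * 6))) = ({4, 4, 4, 4, 10, 10} : Multiset (ZMod 12)) := by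
  decide

/-- Hence `[4,4,4,4,10,10]` mod `12`, in its level-raised form, is a Hodge multiset because `{5,5,2,2,2,2}` mod `6` is; THEOREM F_1♮ (e) applies with the
Fermat fourfold of degree `6` (`(P_6)`, or `isQuasiDecomposable_six₅`).  [locator FERMAT-G33 §2 THEOREM F_q♮ (e), §3]
research route, not a corollary; conditional on HC_CM plus one named minimal statement. -/
theorem isHodgeMultiset_map_levelMul_two_5_5_2_2_2_2 :
    IsHodgeMultiset (({5, 5, 2, 2, 2, 2} : Multiset (ZMod 6)).map fun a ↦ ((2 * a.val : ℕ) : ZMod (2 * 6))) :=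
  (isHodgeMultiset_map_levelMul_iff (by norm_num) (by norm_num) _).mpr isHodgeMultiset_six₅

end Summit.HodgeConjecture.Ring2AbelianAll.FermatQuotientEtaleStep
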